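import Literature.Topology.FourManifolds.LinkLeeStates
import Literature.Topology.FourManifolds.KhComplexProofs
import Literature.Topology.FourManifolds.RasmussenSliceCanonicalProofs
import HarnessLib

/-!
# The crossingless unknot of the two towers: `unknots 1` versus `GaussDiagram.empty` (D2d)

Layer D2d of the link tower `LinkGaussDiagrams` (D1) → `LinkKhResolutions` (D2a) →
`LinkKhComplex` (D2b: `EnhancedState`, `degStates`, `khovanovD`, `leeCycles`, `qMin`,
`LeeHomologyZero`, `classDegree`, `leeSMin/leeSMax`, `rasmussenInvariant`; the correspondence
`enhancedStateEquiv G hG` with the knot tower for `G.n ≠ 0`) → `LinkLeeStates` (D2c: `leeState`,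
`leeMonomial`) → **this file**, which closes the `n = 0` gap of the correspondence at the one
diagram where it matters, the far end of a movie of a slice disc (Rasmussen (2010), §4): the
crossingless round unknot. In the link tower it is `unknots 1` (no chord, ONE free circle), in
the knot tower `GaussDiagram.empty` (no chord, ONE arc, `arcCount = max (2n) 1`); the embedding
`ofGaussDiagram GaussDiagram.empty = unknots 0` is NOT it (`ofGaussDiagram_empty_ne_unknots_one`).

* `enhancedStateUnknotOneEquiv : (unknots 1).EnhancedState ≃ GaussDiagram.empty.EnhancedState`
  (an enhanced state of either diagram is the label `1`/`X` of its single circle), preserving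
  `homDegree` (`0`) and `qDegree` (`±1`); `degStatesUnknotOneEquiv i`; the linear equivalence of
  cochain groups `leeChainUnknotOneEquiv i` (`LinearEquiv.funCongrLeft`), mapping generators to
  generators and preserving `qMin` (`qMin_leeChainUnknotOneEquiv`); `finrank C⁰(unknots 1) = 2`.
* All differentials of both diagrams vanish (`khovanovD_unknots`, `GaussDiagram.khovanovD_empty`):
  `leeCycles = ⊤`, degree-zero boundaries `= ⊥` on both sides; the equivalences of Lee cycles
  (`leeCyclesUnknotOneEquiv`) and of degree-zero Lee homology (`leeHomologyZeroUnknotOneEquiv`,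
  compatible with `Submodule.Quotient.mk` and `classDegree`); hence
  `(unknots 1).leeSMin = GaussDiagram.empty.leeSMin`, same for `leeSMax`, `rasmussenInvariant`.
* **Canonical generators correspond** (`leeChainUnknotOneEquiv_leeMonomial`): the Lee monomial
  `leeMonomial 0 S` of an enhanced state `S` of `unknots 1` (all are canonical,
  `leeState_unknots_bijective`) goes to `2 • (GaussDiagram.empty.leeCoord 0).symm
  (Pi.single ⟨S', _⟩ 1)`, TWICE the knot tower's canonical generator of the corresponding state
  `S'` used in `RasmussenSliceCanonicalProofs` (factor `2 ^ #circles` of Lee's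
  `Mᵀ M = diag 2^{#circles}`); `enhancedStateUnknotOneEquiv (leeState _ t u) = leeState _ (u 0)`.
* **The consumer's interface** (`exists_canonical_of_unknotOne`, `…_symm`): linear maps of
  degree-zero Lee chains `C⁰(G) → C⁰(unknots 1)`, `C⁰(unknots 1) → C⁰(G)` (`G` a knot Gauss
  diagram) respecting boundaries / cycles, not decreasing `qMin` and tracking canonical
  generators with nonzero constants become maps `C⁰(G) ⇄ C⁰(GaussDiagram.empty)` satisfying
  LITERALLY hypotheses (i)–(iv) of `eq_zero_of_isSmoothlySlice_of_canonical`
  (`RasmussenSliceCanonicalProofs`); `eq_zero_of_isSmoothlySlice_of_canonical_unknotOne`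
  restates that assembly with `unknots 1` as the far end, where a movie of Reidemeister and
  Morse moves through link diagrams (Rasmussen (2010), §4.1–4.3) actually ends.

## References

* J. Rasmussen, *Khovanov homology and the slice genus*, Invent. Math. 182 (2010) 419–447
  (arXiv:math/0402131), §2.3 (canonical generators), §3 (the unknot), §4 (movies, Prop. 4.1,
  Cor. 4.2, proof of Thm. 1). [cite: Rasmussen2010, §4]
* E. S. Lee, *An endomorphism of the Khovanov invariant*, Adv. Math. 197 (2005), §4.4
  (the basis `𝐚`, `𝐛`; orthogonality). [cite: Lee2005, §4.4]
* D. Bar-Natan, *On Khovanov's categorification of the Jones polynomial*, Algebr. Geom.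
  Topol. 2 (2002), §3.2 (`⟦◯⟧ = V = ⟨v₊, v₋⟩`). [cite: BarNatan2002, §3.2]

Design: no named fact, no instance. The only arc of `unknots 1` is its free circle
`freeArc = inr 0` (`eq_freeArc`); the arc of `GaussDiagram.empty` is `arcZero`. The consumer's
canonical states of `GaussDiagram.empty`, `{u : degStates 0 // ∀ i, ¬ Free u.1.label i}`
(vacuous condition), are all of `degStates 0`: `leeState _ t` (`canonicalStateEmptyEquiv`).
-/

open Function Set

noncomputable section

namespace Literature.Topology.FourManifolds

/-! ## The knot side: the crossingless diagram `GaussDiagram.empty` -/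

namespace GaussDiagram

/-- For the empty knot diagram every Khovanov differential over every Frobenius system vanishes:
a nonzero incidence number needs a chord to flip. Khovanov (2000), §4.2.
[cite: Khovanov2000, §4.2] -/
theorem khovanovD_empty (R : Type) [CommRing R] (h t : R) (i i' : ℤ) :
    GaussDiagram.empty.khovanovD R h t i i' = 0 := by
  have h0 : (Matrix.of fun (s' : GaussDiagram.empty.degStates i')
      (s : GaussDiagram.empty.degStates i) ↦ GaussDiagram.empty.incidence R h t s.1 s'.1) = 0 := by
    ext s' s
    rw [Matrix.of_apply, Matrix.zero_apply, incidence, dif_neg]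
    exact fun ⟨k, _⟩ ↦ k.elim0
  rw [khovanovD, h0, map_zero]

/-- The degree-zero Lee cycles of the empty knot diagram are all degree-zero chains (`d₀ = 0`).
Rasmussen (2010), §3 (the unknot). [cite: Rasmussen2010, §3] -/
theorem leeCycles_empty : GaussDiagram.empty.leeCycles = ⊤ := by
  change LinearMap.ker _ = ⊤
  rw [khovanovD_empty, LinearMap.ker_zero]

/-- The degree-zero Lee boundaries of the empty knot diagram vanish (`d₋₁ = 0`).
Rasmussen (2010), §3 (the unknot). [cite: Rasmussen2010, §3] -/
theorem range_khovanovD_empty :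
    LinearMap.range (GaussDiagram.empty.khovanovD ℚ 0 1 (0 - 1) 0) = ⊥ := by
  rw [khovanovD_empty, LinearMap.range_zero]

/-- The empty knot diagram satisfies Gauss parity (vacuously: no chord). [folklore] -/
theorem overPos_mod_two_ne_empty (i : Fin GaussDiagram.empty.n) :
    (GaussDiagram.empty.overPos i).val % 2 ≠ (GaussDiagram.empty.underPos i).val % 2 :=
  i.elim0

/-- No chord of the empty diagram is free (there is none): every degree-zero enhanced state is
canonical in the sense of `RasmussenSliceCanonicalProofs`. [folklore] -/
theorem not_free_empty (ℓ : GaussDiagram.empty.Arc → Bool) (i : Fin GaussDiagram.empty.n) :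
    ¬ GaussDiagram.empty.Free ℓ i :=
  i.elim0

/-- The label of Lee's canonical state `leeState _ t` of the empty diagram is `t` on every arc
(there is one arc, `arcZero`). Rasmussen (2010), §2.3. [cite: Rasmussen2010, §2.3] -/
theorem leeState_label_empty
    (hpar : ∀ i, (GaussDiagram.empty.overPos i).val % 2 ≠ (GaussDiagram.empty.underPos i).val % 2)
    (t : Bool) (a : GaussDiagram.empty.Arc) : (GaussDiagram.empty.leeState hpar t).label a = t := by
  haveI : Subsingleton GaussDiagram.empty.Arc := inferInstanceAs (Subsingleton (Fin 1))
  rw [Subsingleton.elim a GaussDiagram.empty.arcZero]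
  exact altLabel_arcZero (G := GaussDiagram.empty) t

/-- **The canonical states of the empty diagram are indexed by `Bool`**: `t ↦ leeState _ t` is a
bijection onto the consumer's type `{u : degStates 0 // ∀ i, ¬ Free u.1.label i}` of
`RasmussenSliceCanonicalProofs` (vacuous condition). [cite: Rasmussen2010, §2.3] -/
def canonicalStateEmptyEquiv
    (hpar : ∀ i, (GaussDiagram.empty.overPos i).val % 2 ≠ (GaussDiagram.empty.underPos i).val % 2) :
    Bool ≃ {u : GaussDiagram.empty.degStates 0 // ∀ i, ¬ GaussDiagram.empty.Free u.1.label i} where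
  toFun t := ⟨⟨GaussDiagram.empty.leeState hpar t, homDegree_leeState hpar t⟩, not_free_empty _⟩
  invFun u := u.1.1.label GaussDiagram.empty.arcZero
  left_inv t := leeState_label_empty hpar t _
  right_inv _ := Subtype.ext (Subtype.ext (EnhancedState.eq_of_label_eq_empty
    GaussDiagram.empty.arcZero (leeState_label_empty hpar _ _)))

/-- **Lee's monomials on the empty diagram**: the column of `s = (∅, ℓ)` of `leeBasisMat 0` has
entry `-1` at `(∅, 1)` if `ℓ = 𝐛`, else `1` (`𝐚 = 1 + X`, `𝐛 = -1 + X`: the one circle, labelled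
`(λ, ℓ)` at `arcZero`, contributes a sign iff `(λ, ℓ) = (1, 𝐛)`). [cite: Lee2005, §4.4] -/
theorem leeBasis_single_empty_apply (s u : GaussDiagram.empty.degStates 0) :
    GaussDiagram.empty.leeBasis 0 (Pi.single s 1) u =
      if (!u.1.label GaussDiagram.empty.arcZero && s.1.label GaussDiagram.empty.arcZero) = true
      then -1 else 1 := by
  haveI : IsEmpty (Fin GaussDiagram.empty.n) := inferInstanceAs (IsEmpty (Fin 0))
  haveI : Subsingleton GaussDiagram.empty.Arc := inferInstanceAs (Subsingleton (Fin 1))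
  haveI : Subsingleton (GaussDiagram.empty.StateCircle s.1.state) :=
    Fintype.card_le_one_iff_subsingleton.mp (card_stateCircle_empty _).le
  have huniv : (Finset.univ : Finset (GaussDiagram.empty.StateCircle s.1.state)) =
      {GaussDiagram.empty.circleOf s.1.state GaussDiagram.empty.arcZero} :=
    Finset.eq_singleton_iff_unique_mem.2 ⟨Finset.mem_univ _, fun c _ ↦ Subsingleton.elim _ _⟩
  have h : (∃ a, GaussDiagram.empty.circleOf s.1.state a =
      GaussDiagram.empty.circleOf s.1.state GaussDiagram.empty.arcZero ∧
      (!u.1.label a && s.1.label a) = true) ↔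
      (!u.1.label GaussDiagram.empty.arcZero && s.1.label GaussDiagram.empty.arcZero) = true :=
    ⟨fun ⟨a, _, ha⟩ ↦ by rwa [Subsingleton.elim GaussDiagram.empty.arcZero a],
      fun ha ↦ ⟨_, rfl, ha⟩⟩
  rw [leeBasis_apply, Matrix.toLin'_apply, Matrix.mulVec_single_one]
  change (if u.1.state = s.1.state then
    (-1 : ℚ) ^ GaussDiagram.empty.pairCount s.1.state u.1.label s.1.label else 0) = _
  rw [if_pos (Subsingleton.elim _ _), pairCount, huniv, Finset.filter_singleton]
  simp only [h]
  split_ifs <;> simp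

/-- **The knot tower's canonical generator of the unknot**: twice the dual generator
`(leeCoord 0).symm (Pi.single s 1)` of `RasmussenSliceCanonicalProofs` is Lee's monomial
`leeBasis 0 (Pi.single s 1)` (`Mᵀ M = diag 2^{#circles}`, one circle). [cite: Lee2005, §4.4] -/
theorem two_smul_leeCoord_symm_single_empty (s : GaussDiagram.empty.degStates 0) :
    (2 : ℚ) • (GaussDiagram.empty.leeCoord 0).symm (Pi.single s 1) =
      GaussDiagram.empty.leeBasis 0 (Pi.single s 1) := by
  apply (GaussDiagram.empty.leeCoord 0).injective
  rw [map_smul, LinearEquiv.apply_symm_apply, leeCoord_apply, leeBasis_apply,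
    ← Matrix.toLin'_mul_apply, leeBasisMat_transpose_mul, Matrix.toLin'_apply]
  ext u
  rw [Matrix.mulVec_diagonal, Pi.smul_apply, smul_eq_mul,
    show GaussDiagram.empty.circleCount u.1.state = 1 from card_stateCircle_empty _, pow_one]

end GaussDiagram

namespace LinkGaussDiagram

/-! ## The link side: zero differentials of `unknots k`; the single arc of `unknots 1` -/

/-- For the crossingless unlink diagrams every Khovanov differential over every Frobenius system
vanishes (no chord, no flip). Khovanov (2000), §4.2. [cite: Khovanov2000, §4.2] -/
theorem khovanovD_unknots (k : ℕ) (R : Type) [CommRing R] (h t : R) (i i' : ℤ) :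
    (unknots k).khovanovD R h t i i' = 0 := by
  have h0 : (Matrix.of fun (s' : (unknots k).degStates i') (s : (unknots k).degStates i) ↦
      (unknots k).incidence R h t s.1 s'.1) = 0 := by
    ext s' s
    rw [Matrix.of_apply, Matrix.zero_apply, incidence_of_not_flip]
    exact fun ⟨j, _⟩ ↦ isEmptyElim j
  rw [khovanovD, h0, map_zero]

/-- The degree-zero Lee cycles of an unlink diagram are all degree-zero chains (`d₀ = 0`).
[cite: Rasmussen2010, §2.3] -/
theorem leeCycles_unknots (k : ℕ) : (unknots k).leeCycles = ⊤ := by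
  change LinearMap.ker _ = ⊤
  rw [khovanovD_unknots, LinearMap.ker_zero]

/-- The degree-zero Lee boundaries of an unlink diagram vanish (`d₋₁ = 0`).
[cite: Rasmussen2010, §2.3] -/
theorem range_khovanovD_unknots (k : ℕ) :
    LinearMap.range ((unknots k).khovanovD ℚ 0 1 (0 - 1) 0) = ⊥ := by
  rw [khovanovD_unknots, LinearMap.range_zero]

/-- The free circle of the crossingless unknot diagram `unknots 1`: its only arc. [folklore] -/
abbrev freeArc : (unknots 1).Arc := .inr (0 : Fin 1)

/-- `unknots 1` has a single arc, the free circle. [folklore] -/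
theorem eq_freeArc (a : (unknots 1).Arc) : a = freeArc := by
  rcases a with q | j
  · exact absurd q.isLt (Nat.not_lt_zero _)
  · rw [Fin.fin_one_eq_zero j]

/-- The quantum degree of an enhanced state of `unknots 1` is `1` for the label `1` and `-1` for
the label `X` of its circle, as `GaussDiagram.qDegree_empty_eq`. [cite: BarNatan2002, §3.2] -/
theorem qDegree_unknots_one (s : (unknots 1).EnhancedState) :
    qDegree s = if s.label freeArc = true then -1 else 1 := by
  rw [qDegree_unknots, Finset.card_filter, Finset.card_filter, Fin.sum_univ_one, Fin.sum_univ_one]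
  change ((if s.label freeArc = false then 1 else 0 : ℕ) : ℤ) -
    ((if s.label freeArc = true then 1 else 0 : ℕ) : ℤ) = _
  cases s.label freeArc <;> simp

/-- **Lee's monomials on `unknots 1`**: the monomial of `S = (∅, ℓ)` has coefficient `-1` on
`(∅, 1)` if `ℓ = 𝐛`, else `1` (`𝐚 = 1 + X`, `𝐛 = -1 + X`: the one circle, labelled `(λ, ℓ)`,
contributes a sign iff `(λ, ℓ) = (1, 𝐛)`). Lee (2005), §4.4. [cite: Lee2005, §4.4] -/
theorem leeMonomial_unknots_one_apply (S : (unknots 1).EnhancedState)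
    (s₁ : (unknots 1).degStates 0) :
    (unknots 1).leeMonomial 0 S s₁ =
      if (!s₁.1.label freeArc && S.label freeArc) = true then -1 else 1 := by
  haveI : Subsingleton ((unknots 1).StateCircle S.state) :=
    (stateCircleUnknotsEquiv 1 S.state).symm.subsingleton
  have huniv : (Finset.univ : Finset ((unknots 1).StateCircle S.state)) =
      {(unknots 1).circleOf S.state freeArc} :=
    Finset.eq_singleton_iff_unique_mem.2 ⟨Finset.mem_univ _, fun c _ ↦ Subsingleton.elim _ _⟩
  have h : (∃ a, (unknots 1).circleOf S.state a = (unknots 1).circleOf S.state freeArc ∧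
      (!s₁.1.label a && S.label a) = true) ↔ (!s₁.1.label freeArc && S.label freeArc) = true :=
    ⟨fun ⟨a, _, ha⟩ ↦ by rwa [← eq_freeArc a], fun ha ↦ ⟨freeArc, rfl, ha⟩⟩
  rw [leeMonomial, if_pos (Subsingleton.elim _ _), pairCount, huniv, Finset.filter_singleton]
  simp only [h]
  split_ifs <;> simp

/-! ## Enhanced states and cochain groups of `unknots 1` and `GaussDiagram.empty` correspond -/

/-- **The enhanced states of the crossingless unknot diagrams of the two towers correspond**:
an enhanced state of `unknots 1` is the label of its free circle, one of `GaussDiagram.empty` is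
the label of its single arc; the state is unique. [cite: BarNatan2002, §3.2] -/
def enhancedStateUnknotOneEquiv :
    (unknots 1).EnhancedState ≃ GaussDiagram.empty.EnhancedState where
  toFun s := ⟨s.state, fun _ ↦ s.label freeArc, fun _ _ _ ↦ rfl⟩
  invFun s := ⟨s.state, fun _ ↦ s.label GaussDiagram.empty.arcZero, fun _ _ _ ↦ rfl⟩
  left_inv s := EnhancedState.ext' rfl (funext fun a ↦ by
    change s.label freeArc = s.label a
    rw [eq_freeArc a])
  right_inv s := GaussDiagram.EnhancedState.ext' rfl (funext fun a ↦ by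
    haveI : Subsingleton GaussDiagram.empty.Arc := inferInstanceAs (Subsingleton (Fin 1))
    change s.label GaussDiagram.empty.arcZero = s.label a
    rw [Subsingleton.elim a GaussDiagram.empty.arcZero])

/-- The corresponding knot enhanced state carries the label of the free circle. [folklore] -/
@[simp] theorem enhancedStateUnknotOneEquiv_label (s : (unknots 1).EnhancedState)
    (a : GaussDiagram.empty.Arc) : (enhancedStateUnknotOneEquiv s).label a = s.label freeArc :=
  rfl

/-- Homological degrees correspond (both vanish). [cite: BarNatan2002, §3.2] -/
theorem homDegree_enhancedStateUnknotOneEquiv (s : (unknots 1).EnhancedState) :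
    GaussDiagram.homDegree (enhancedStateUnknotOneEquiv s) = homDegree s :=
  (GaussDiagram.homDegree_empty _).trans (homDegree_unknots 1 s).symm

/-- Quantum degrees correspond (`+1` for the label `1`, `-1` for the label `X`).
[cite: BarNatan2002, §3.2] -/
theorem qDegree_enhancedStateUnknotOneEquiv (s : (unknots 1).EnhancedState) :
    GaussDiagram.qDegree (enhancedStateUnknotOneEquiv s) = qDegree s := by
  rw [GaussDiagram.qDegree_empty_eq _ GaussDiagram.empty.arcZero, qDegree_unknots_one,
    enhancedStateUnknotOneEquiv_label]

/-- **Canonical states correspond**: Lee's canonical state `leeState _ t u` of `unknots 1` (free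
circle labelled `u 0`; `t`, `c` are invisible) goes to `GaussDiagram.empty.leeState _ (u 0)`.
Rasmussen (2010), §2.3. [cite: Rasmussen2010, §2.3] -/
theorem enhancedStateUnknotOneEquiv_leeState {c : Fin (2 * (unknots 1).n) → Bool}
    (hc : (unknots 1).IsCheckerboard c) (t : Bool) (u : Fin 1 → Bool)
    (hpar : ∀ i, (GaussDiagram.empty.overPos i).val % 2 ≠ (GaussDiagram.empty.underPos i).val % 2) :
    enhancedStateUnknotOneEquiv ((unknots 1).leeState hc t u) =
      GaussDiagram.empty.leeState hpar (u 0) :=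
  GaussDiagram.EnhancedState.eq_of_label_eq_empty GaussDiagram.empty.arcZero
    (GaussDiagram.leeState_label_empty hpar _ _).symm

/-- **Degree pieces correspond**: `enhancedStateUnknotOneEquiv` between the enhanced states of
homological degree `i` (all of them for `i = 0`, none otherwise). [cite: BarNatan2002, §3.2] -/
def degStatesUnknotOneEquiv (i : ℤ) : (unknots 1).degStates i ≃ GaussDiagram.empty.degStates i :=
  enhancedStateUnknotOneEquiv.subtypeEquiv fun s ↦ by rw [homDegree_enhancedStateUnknotOneEquiv]

/-- Quantum degrees of basis elements correspond. [cite: BarNatan2002, §3.2] -/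
theorem qDegree_degStatesUnknotOneEquiv (i : ℤ) (s : (unknots 1).degStates i) :
    GaussDiagram.qDegree (degStatesUnknotOneEquiv i s).1 = qDegree s.1 :=
  qDegree_enhancedStateUnknotOneEquiv s.1

/-- **Sanity**: the degree-zero Lee cochain group of `unknots 1` is `2`-dimensional (two
enhanced states, `V = ⟨1, X⟩`). Bar-Natan (2002), §3.2. [cite: BarNatan2002, §3.2] -/
theorem finrank_degStates_unknots_one :
    Module.finrank ℚ ((unknots 1).degStates 0 → ℚ) = 2 := by
  rw [Module.finrank_fintype_fun_eq_card,
    Fintype.card_congr (Equiv.subtypeUnivEquiv (homDegree_unknots 1)),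
    card_enhancedState_unknots, pow_one]

/-- **Sanity**: the knot tower's empty diagram embeds as `unknots 0` (ONE enhanced state,
`card_enhancedState_unknots 0`), NOT as the crossingless unknot `unknots 1`. [folklore] -/
theorem ofGaussDiagram_empty_ne_unknots_one : ofGaussDiagram GaussDiagram.empty ≠ unknots 1 := by
  rw [ofGaussDiagram_empty]
  exact fun h ↦ absurd (congrArg LinkGaussDiagram.free h) Nat.zero_ne_one

/-- **The linear equivalence of cochain groups** induced by `degStatesUnknotOneEquiv` (relabelling
of the bases, `LinearEquiv.funCongrLeft`): `x ↦ x ∘ (degStatesUnknotOneEquiv i)⁻¹`. [folklore] -/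
def leeChainUnknotOneEquiv (i : ℤ) :
    ((unknots 1).degStates i → ℚ) ≃ₗ[ℚ] (GaussDiagram.empty.degStates i → ℚ) :=
  LinearEquiv.funCongrLeft ℚ ℚ (degStatesUnknotOneEquiv i).symm

/-- The equivalence of cochain groups, evaluated. [folklore] -/
@[simp] theorem leeChainUnknotOneEquiv_apply (i : ℤ) (x : (unknots 1).degStates i → ℚ)
    (u : GaussDiagram.empty.degStates i) :
    leeChainUnknotOneEquiv i x u = x ((degStatesUnknotOneEquiv i).symm u) :=
  rfl

/-- The equivalence of cochain groups maps basis vectors to basis vectors. [folklore] -/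
theorem leeChainUnknotOneEquiv_single (i : ℤ) (s : (unknots 1).degStates i) (c : ℚ) :
    leeChainUnknotOneEquiv i (Pi.single s c) = Pi.single (degStatesUnknotOneEquiv i s) c := by
  change Pi.single s c ∘ (degStatesUnknotOneEquiv i).symm = _
  rw [Pi.single_comp_equiv, Equiv.symm_symm]

/-- The equivalence carries degree-zero Lee cycles onto degree-zero Lee cycles (both are
everything). [cite: Rasmussen2010, §2.3] -/
theorem map_leeCycles_leeChainUnknotOneEquiv :
    (unknots 1).leeCycles.map (leeChainUnknotOneEquiv 0).toLinearMap =
      GaussDiagram.empty.leeCycles := by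
  rw [leeCycles_unknots, GaussDiagram.leeCycles_empty, Submodule.map_top, LinearEquiv.range]

/-- The equivalence carries degree-zero Lee boundaries onto degree-zero Lee boundaries (both
vanish). [cite: Rasmussen2010, §2.3] -/
theorem map_range_khovanovD_leeChainUnknotOneEquiv :
    (LinearMap.range ((unknots 1).khovanovD ℚ 0 1 (0 - 1) 0)).map
        (leeChainUnknotOneEquiv 0).toLinearMap =
      LinearMap.range (GaussDiagram.empty.khovanovD ℚ 0 1 (0 - 1) 0) := by
  rw [range_khovanovD_unknots, GaussDiagram.range_khovanovD_empty, Submodule.map_bot]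

/-- **The equivalence preserves the filtration degree** (supports correspond under
`degStatesUnknotOneEquiv 0`, which preserves `qDegree`). [cite: Rasmussen2010, §2.2] -/
theorem qMin_leeChainUnknotOneEquiv (x : (unknots 1).degStates 0 → ℚ) :
    GaussDiagram.qMin (leeChainUnknotOneEquiv 0 x) = qMin x := by
  unfold GaussDiagram.qMin qMin
  symm
  refine Equiv.iInf_congr (degStatesUnknotOneEquiv 0) fun s ↦ ?_
  simp only [Set.mem_setOf_eq, leeChainUnknotOneEquiv_apply, Equiv.symm_apply_apply,
    qDegree_degStatesUnknotOneEquiv]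

/-- The inverse equivalence preserves the filtration degree. [cite: Rasmussen2010, §2.2] -/
theorem qMin_leeChainUnknotOneEquiv_symm (y : GaussDiagram.empty.degStates 0 → ℚ) :
    qMin ((leeChainUnknotOneEquiv 0).symm y) = GaussDiagram.qMin y := by
  rw [← qMin_leeChainUnknotOneEquiv, LinearEquiv.apply_symm_apply]

/-! ## Canonical generators correspond -/

/-- **The Lee monomial is twice the knot tower's canonical generator.** For every enhanced state
`S` of `unknots 1` (all of them are canonical), the transport of `leeMonomial 0 S` is
`2 • (GaussDiagram.empty.leeCoord 0).symm (Pi.single ⟨S', _⟩ 1)`, `S'` the corresponding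
enhanced state of `GaussDiagram.empty`: both are Lee's monomial `𝐚 = 1 + X` or `𝐛 = -1 + X`
(the `n = 0` case of `funCongrLeft_leeCoord_symm_single`). [cite: Rasmussen2010, §2.3] -/
theorem leeChainUnknotOneEquiv_leeMonomial (S : (unknots 1).EnhancedState) :
    leeChainUnknotOneEquiv 0 ((unknots 1).leeMonomial 0 S) =
      (2 : ℚ) • (GaussDiagram.empty.leeCoord 0).symm
        (Pi.single ⟨enhancedStateUnknotOneEquiv S, GaussDiagram.homDegree_empty _⟩ 1) := by
  rw [GaussDiagram.two_smul_leeCoord_symm_single_empty]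
  ext u
  rw [leeChainUnknotOneEquiv_apply, leeMonomial_unknots_one_apply,
    GaussDiagram.leeBasis_single_empty_apply]
  rfl

/-- The same for Lee's canonical states `leeState _ t u` of `unknots 1` and the generator
`(leeCoord 0).symm (Pi.single ⟨leeState hpar (u 0), _⟩ 1)` of the knot tower.
[cite: Rasmussen2010, §2.3] -/
theorem leeChainUnknotOneEquiv_leeMonomial_leeState {c : Fin (2 * (unknots 1).n) → Bool}
    (hc : (unknots 1).IsCheckerboard c) (t : Bool) (u : Fin 1 → Bool)
    (hpar : ∀ i, (GaussDiagram.empty.overPos i).val % 2 ≠ (GaussDiagram.empty.underPos i).val % 2) :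
    leeChainUnknotOneEquiv 0 ((unknots 1).leeMonomial 0 ((unknots 1).leeState hc t u)) =
      (2 : ℚ) • (GaussDiagram.empty.leeCoord 0).symm
        (Pi.single ⟨GaussDiagram.empty.leeState hpar (u 0),
          GaussDiagram.homDegree_leeState hpar (u 0)⟩ 1) := by
  have hS : (⟨enhancedStateUnknotOneEquiv ((unknots 1).leeState hc t u),
      GaussDiagram.homDegree_empty _⟩ : GaussDiagram.empty.degStates 0) =
      ⟨GaussDiagram.empty.leeState hpar (u 0), GaussDiagram.homDegree_leeState hpar (u 0)⟩ :=
    Subtype.ext (enhancedStateUnknotOneEquiv_leeState hc t u hpar)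
  rw [leeChainUnknotOneEquiv_leeMonomial, hS]

/-- **Backwards**: the knot tower's canonical generator of `u` is carried to half the Lee
monomial of the corresponding enhanced state of `unknots 1`. [cite: Lee2005, §4.4] -/
theorem leeChainUnknotOneEquiv_symm_leeCoord_symm_single (u : GaussDiagram.empty.degStates 0) :
    (leeChainUnknotOneEquiv 0).symm ((GaussDiagram.empty.leeCoord 0).symm (Pi.single u 1)) =
      (1 / 2 : ℚ) • (unknots 1).leeMonomial 0 (enhancedStateUnknotOneEquiv.symm u.1) := by
  apply (leeChainUnknotOneEquiv 0).injective
  rw [LinearEquiv.apply_symm_apply, map_smul, leeChainUnknotOneEquiv_leeMonomial, smul_smul]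
  have hu : (⟨enhancedStateUnknotOneEquiv (enhancedStateUnknotOneEquiv.symm u.1),
      GaussDiagram.homDegree_empty _⟩ : GaussDiagram.empty.degStates 0) = u :=
    Subtype.ext (Equiv.apply_symm_apply _ _)
  rw [hu]
  norm_num

/-! ## Lee cycles, Lee homology and the numerical invariants correspond -/

/-- **Degree-zero Lee cycles correspond** (restriction of `leeChainUnknotOneEquiv 0`).
Rasmussen (2010), §2.3. [cite: Rasmussen2010, §2.3] -/
def leeCyclesUnknotOneEquiv : (unknots 1).leeCycles ≃ₗ[ℚ] GaussDiagram.empty.leeCycles :=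
  (leeChainUnknotOneEquiv 0).ofSubmodules _ _ map_leeCycles_leeChainUnknotOneEquiv

/-- The equivalence of cycles is the equivalence of chains on the underlying chain. [folklore] -/
@[simp] theorem leeCyclesUnknotOneEquiv_apply_val (z : (unknots 1).leeCycles) :
    (leeCyclesUnknotOneEquiv z).1 = leeChainUnknotOneEquiv 0 z.1 :=
  rfl

/-- **Degree-zero Lee homology corresponds**: the equivalence of cycles descends to the quotients
by the boundaries (both zero). Lee (2005), Thm. 4.2 (the unknot). [cite: Rasmussen2010, §2.3] -/
def leeHomologyZeroUnknotOneEquiv :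
    (unknots 1).LeeHomologyZero ≃ₗ[ℚ] GaussDiagram.empty.LeeHomologyZero :=
  Submodule.Quotient.equiv _ _ leeCyclesUnknotOneEquiv (by
    rw [range_khovanovD_unknots, GaussDiagram.range_khovanovD_empty, Submodule.comap_bot,
      Submodule.comap_bot, Submodule.ker_subtype, Submodule.ker_subtype, Submodule.map_bot])

/-- The equivalence of homologies on classes of cycles. [folklore] -/
@[simp] theorem leeHomologyZeroUnknotOneEquiv_mk (z : (unknots 1).leeCycles) :
    leeHomologyZeroUnknotOneEquiv (Submodule.Quotient.mk z) =
      (Submodule.Quotient.mk (leeCyclesUnknotOneEquiv z) : GaussDiagram.empty.LeeHomologyZero) :=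
  rfl

/-- **Rasmussen's `s(α)` corresponds** under the equivalence of homologies (representatives
correspond under `leeCyclesUnknotOneEquiv`, which preserves `qMin`). [cite: Rasmussen2010, §2.2] -/
theorem classDegree_leeHomologyZeroUnknotOneEquiv (α : (unknots 1).LeeHomologyZero) :
    GaussDiagram.classDegree (leeHomologyZeroUnknotOneEquiv α) = classDegree α := by
  unfold GaussDiagram.classDegree classDegree
  symm
  refine Equiv.iSup_congr leeCyclesUnknotOneEquiv.toEquiv fun z ↦ ?_
  have hmk : Submodule.Quotient.mk (leeCyclesUnknotOneEquiv z) = leeHomologyZeroUnknotOneEquiv α ↔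
      Submodule.Quotient.mk z = α :=
    leeHomologyZeroUnknotOneEquiv.injective.eq_iff (a := Submodule.Quotient.mk z) (b := α)
  simp only [Set.mem_setOf_eq, LinearEquiv.coe_toEquiv, hmk, leeCyclesUnknotOneEquiv_apply_val,
    qMin_leeChainUnknotOneEquiv]

/-- **`s_min` corresponds**: `s_min (unknots 1) = s_min (GaussDiagram.empty)` (nonzero classes and
their filtration degrees correspond). Rasmussen (2010), Def. 3.1. [cite: Rasmussen2010, §3] -/
theorem leeSMin_unknots_one : (unknots 1).leeSMin = GaussDiagram.empty.leeSMin := by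
  unfold leeSMin GaussDiagram.leeSMin
  refine Equiv.iInf_congr leeHomologyZeroUnknotOneEquiv.toEquiv fun α ↦ ?_
  simp only [Set.mem_setOf_eq, LinearEquiv.coe_toEquiv, ne_eq, LinearEquiv.map_eq_zero_iff,
    classDegree_leeHomologyZeroUnknotOneEquiv]

/-- **`s_max` corresponds**: `s_max (unknots 1) = s_max (GaussDiagram.empty)` (`= 1`,
`leeSMax_unknots`, `leeSMax_empty`). Rasmussen (2010), Def. 3.1, §3. [cite: Rasmussen2010, §3] -/
theorem leeSMax_unknots_one : (unknots 1).leeSMax = GaussDiagram.empty.leeSMax := by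
  unfold leeSMax GaussDiagram.leeSMax
  refine Equiv.iSup_congr leeHomologyZeroUnknotOneEquiv.toEquiv fun α ↦ ?_
  simp only [Set.mem_setOf_eq, LinearEquiv.coe_toEquiv, ne_eq, LinearEquiv.map_eq_zero_iff,
    classDegree_leeHomologyZeroUnknotOneEquiv]

/-- **Rasmussen's `s` corresponds**: `s (unknots 1) = s (GaussDiagram.empty)` (`= 0`,
`rasmussenInvariant_unknots_one`, `rasmussenInvariant_empty`). [cite: Rasmussen2010, §3] -/
theorem rasmussenInvariant_unknots_one_eq :
    (unknots 1).rasmussenInvariant = GaussDiagram.empty.rasmussenInvariant := by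
  rw [rasmussenInvariant, GaussDiagram.rasmussenInvariant, leeSMax_unknots_one]

/-! ## The consumer's interface: the hypotheses of `eq_zero_of_isSmoothlySlice_of_canonical` -/

/-- **Forward maps.** Let `G` be a knot Gauss diagram and `F : C⁰(G) → C⁰(unknots 1)` a linear
map of degree-zero Lee chains which (ii) sends boundaries to boundaries, (iii) does not decrease
`qMin`, and (iv) sends the canonical generator `(G.leeCoord 0).symm (Pi.single s 1)` of each
canonical state `s` of `G` to a nonzero multiple of the Lee monomial of an enhanced state `e s`
of `unknots 1` modulo boundaries, injectively in `s` (Prop. 4.1 for a movie `G → ⋯ → unknots 1`;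
(i) "cycles to cycles" is automatic, `leeCycles_unknots`). Then `leeChainUnknotOneEquiv 0 ∘ F`
satisfies LITERALLY the hypotheses (i)–(iv) of the first half of
`eq_zero_of_isSmoothlySlice_of_canonical` (`RasmussenSliceCanonicalProofs`), constants doubled
(`leeChainUnknotOneEquiv_leeMonomial`). Rasmussen (2010), §4.2, Prop. 4.1, Cor. 4.2.
[cite: Rasmussen2010, §4] -/
theorem exists_canonical_of_unknotOne {G : GaussDiagram}
    (F : (G.degStates 0 → ℚ) →ₗ[ℚ] ((unknots 1).degStates 0 → ℚ))
    (hFA : ∀ y, F (G.khovanovD ℚ 0 1 (0 - 1) 0 y) ∈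
      LinearMap.range ((unknots 1).khovanovD ℚ 0 1 (0 - 1) 0))
    (hFq : ∀ x, GaussDiagram.qMin x ≤ qMin (F x))
    (e : {s : G.degStates 0 // ∀ i, ¬ G.Free s.1.label i} → (unknots 1).EnhancedState)
    (he : Injective e)
    (htrack : ∀ s, ∃ c : ℚ, c ≠ 0 ∧
      F ((G.leeCoord 0).symm (Pi.single s.1 1)) - c • (unknots 1).leeMonomial 0 (e s) ∈
        LinearMap.range ((unknots 1).khovanovD ℚ 0 1 (0 - 1) 0)) :
    ∃ F' : (G.degStates 0 → ℚ) →ₗ[ℚ] (GaussDiagram.empty.degStates 0 → ℚ),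
      (∀ z ∈ G.leeCycles, F' z ∈ GaussDiagram.empty.leeCycles) ∧
      (∀ y, F' (G.khovanovD ℚ 0 1 (0 - 1) 0 y) ∈
        LinearMap.range (GaussDiagram.empty.khovanovD ℚ 0 1 (0 - 1) 0)) ∧
      (∀ x, GaussDiagram.qMin x ≤ GaussDiagram.qMin (F' x)) ∧
      ∃ e' : {s : G.degStates 0 // ∀ i, ¬ G.Free s.1.label i} →
          {u : GaussDiagram.empty.degStates 0 // ∀ i, ¬ GaussDiagram.empty.Free u.1.label i},
        Injective e' ∧ ∀ s, ∃ c : ℚ, c ≠ 0 ∧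
          F' ((G.leeCoord 0).symm (Pi.single s.1 1)) -
              c • (GaussDiagram.empty.leeCoord 0).symm (Pi.single (e' s).1 1) ∈
            LinearMap.range (GaussDiagram.empty.khovanovD ℚ 0 1 (0 - 1) 0) := by
  refine ⟨(leeChainUnknotOneEquiv 0).toLinearMap ∘ₗ F, fun z _ ↦ ?_, fun y ↦ ?_, fun x ↦ ?_,
    fun s ↦ ⟨⟨enhancedStateUnknotOneEquiv (e s), GaussDiagram.homDegree_empty _⟩,
      GaussDiagram.not_free_empty _⟩, fun s s' h ↦ ?_, fun s ↦ ?_⟩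
  · rw [GaussDiagram.leeCycles_empty]
    exact Submodule.mem_top
  · rw [← map_range_khovanovD_leeChainUnknotOneEquiv]
    exact Submodule.mem_map_of_mem (hFA y)
  · rw [LinearMap.comp_apply, LinearEquiv.coe_coe, qMin_leeChainUnknotOneEquiv]
    exact hFq x
  · exact he (enhancedStateUnknotOneEquiv.injective (Subtype.ext_iff.1 (Subtype.ext_iff.1 h)))
  · obtain ⟨c, hc0, hc⟩ := htrack s
    refine ⟨c * 2, mul_ne_zero hc0 two_ne_zero, ?_⟩
    rw [← map_range_khovanovD_leeChainUnknotOneEquiv]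
    refine ⟨_, hc, ?_⟩
    rw [LinearEquiv.coe_coe, map_sub, map_smul, leeChainUnknotOneEquiv_leeMonomial, smul_smul]
    rfl

/-- **Backward maps.** Let `G` be a knot Gauss diagram and `Ψ : C⁰(unknots 1) → C⁰(G)` a linear
map of degree-zero Lee chains which (i) sends cycles to cycles, (iii) does not decrease `qMin`,
and (iv) sends the Lee monomial of each enhanced state `S` of `unknots 1` to a nonzero multiple
of the canonical generator of a canonical state `e S` of `G` modulo boundaries, injectively in
`S` (Prop. 4.1 for a movie `unknots 1 → ⋯ → G`; (ii) "boundaries to boundaries" is automatic,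
`unknots 1` has no chain of degree `-1`). Then `Ψ ∘ (leeChainUnknotOneEquiv 0)⁻¹` satisfies
LITERALLY the hypotheses (i)–(iv) of the second half of `eq_zero_of_isSmoothlySlice_of_canonical`,
constants halved (`leeChainUnknotOneEquiv_symm_leeCoord_symm_single`). Rasmussen (2010), §4.2,
Prop. 4.1, Cor. 4.2. [cite: Rasmussen2010, §4] -/
theorem exists_canonical_of_unknotOne_symm {G : GaussDiagram}
    (Ψ : ((unknots 1).degStates 0 → ℚ) →ₗ[ℚ] (G.degStates 0 → ℚ))
    (hΨB : ∀ w ∈ (unknots 1).leeCycles, Ψ w ∈ G.leeCycles)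
    (hΨq : ∀ x, qMin x ≤ GaussDiagram.qMin (Ψ x))
    (e : (unknots 1).EnhancedState → {s : G.degStates 0 // ∀ i, ¬ G.Free s.1.label i})
    (he : Injective e)
    (htrack : ∀ S, ∃ c : ℚ, c ≠ 0 ∧
      Ψ ((unknots 1).leeMonomial 0 S) - c • (G.leeCoord 0).symm (Pi.single (e S).1 1) ∈
        LinearMap.range (G.khovanovD ℚ 0 1 (0 - 1) 0)) :
    ∃ Ψ' : (GaussDiagram.empty.degStates 0 → ℚ) →ₗ[ℚ] (G.degStates 0 → ℚ),
      (∀ w ∈ GaussDiagram.empty.leeCycles, Ψ' w ∈ G.leeCycles) ∧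
      (∀ y, Ψ' (GaussDiagram.empty.khovanovD ℚ 0 1 (0 - 1) 0 y) ∈
        LinearMap.range (G.khovanovD ℚ 0 1 (0 - 1) 0)) ∧
      (∀ x, GaussDiagram.qMin x ≤ GaussDiagram.qMin (Ψ' x)) ∧
      ∃ e' : {u : GaussDiagram.empty.degStates 0 // ∀ i, ¬ GaussDiagram.empty.Free u.1.label i} →
          {s : G.degStates 0 // ∀ i, ¬ G.Free s.1.label i},
        Injective e' ∧ ∀ u, ∃ c : ℚ, c ≠ 0 ∧
          Ψ' ((GaussDiagram.empty.leeCoord 0).symm (Pi.single u.1 1)) -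
              c • (G.leeCoord 0).symm (Pi.single (e' u).1 1) ∈
            LinearMap.range (G.khovanovD ℚ 0 1 (0 - 1) 0) := by
  refine ⟨Ψ ∘ₗ (leeChainUnknotOneEquiv 0).symm.toLinearMap, fun w _ ↦ ?_, fun y ↦ ?_, fun x ↦ ?_,
    fun u ↦ e (enhancedStateUnknotOneEquiv.symm u.1.1), fun u u' h ↦ ?_, fun u ↦ ?_⟩
  · refine hΨB _ ?_
    rw [leeCycles_unknots]
    exact Submodule.mem_top
  · rw [GaussDiagram.khovanovD_empty, LinearMap.zero_apply, map_zero]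
    exact Submodule.zero_mem _
  · rw [LinearMap.comp_apply, LinearEquiv.coe_coe, ← qMin_leeChainUnknotOneEquiv_symm x]
    exact hΨq _
  · exact Subtype.ext (Subtype.ext (enhancedStateUnknotOneEquiv.symm.injective (he h)))
  · obtain ⟨c, hc0, hc⟩ := htrack (enhancedStateUnknotOneEquiv.symm u.1.1)
    refine ⟨1 / 2 * c, mul_ne_zero (by norm_num) hc0, ?_⟩
    rw [LinearMap.comp_apply, LinearEquiv.coe_coe, leeChainUnknotOneEquiv_symm_leeCoord_symm_single,
      map_smul, ← smul_smul, ← smul_sub]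
    exact Submodule.smul_mem _ _ hc

end LinkGaussDiagram

/-! ## The assembly with `unknots 1` as the far end -/

/-- **Rasmussen's argument for slice knots at the chain level, ending at `unknots 1`.** Suppose
that every regular projection `P` of every smoothly slice knot comes with linear maps of
degree-zero Lee chains `F : C⁰(P.diagram) → C⁰(unknots 1)`, `Ψ : C⁰(unknots 1) → C⁰(P.diagram)`
(`unknots 1` the crossingless unknot of the LINK tower: the actual far end of a movie of
Reidemeister and Morse moves presenting the concordance cut out of a slice disc, Rasmussen
(2010), §4.1–4.3) such that `F` sends boundaries to boundaries, `Ψ` cycles to cycles, neither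
decreases `qMin` (filtered of degree `χ(C) = 0`, §4.2), and both track canonical generators
with nonzero constants modulo boundaries, injectively (Prop. 4.1; on `unknots 1` the canonical
generators are the Lee monomials `leeMonomial 0 S` of its two enhanced states). Then the named
fact `eq_zero_of_isSmoothlySlice` holds (`exists_canonical_of_unknotOne(_symm)` feed
`eq_zero_of_isSmoothlySlice_of_canonical`). Rasmussen (2010), Thm. 1 (§4.4), Cor. 4.2,
Prop. 4.1. [cite: Rasmussen2010, Thm. 1] -/
theorem eq_zero_of_isSmoothlySlice_of_canonical_unknotOne
    (h : ∀ {K : Knot} (P : K.RegularProjection), K.IsSmoothlySlice →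
      (∃ F : (P.diagram.degStates 0 → ℚ) →ₗ[ℚ]
          ((LinkGaussDiagram.unknots 1).degStates 0 → ℚ),
        (∀ y, F (P.diagram.khovanovD ℚ 0 1 (0 - 1) 0 y) ∈
          LinearMap.range ((LinkGaussDiagram.unknots 1).khovanovD ℚ 0 1 (0 - 1) 0)) ∧
        (∀ x, GaussDiagram.qMin x ≤ LinkGaussDiagram.qMin (F x)) ∧
        ∃ e : {s : P.diagram.degStates 0 // ∀ i, ¬ P.diagram.Free s.1.label i} →
            (LinkGaussDiagram.unknots 1).EnhancedState,
          Injective e ∧ ∀ s, ∃ c : ℚ, c ≠ 0 ∧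
            F ((P.diagram.leeCoord 0).symm (Pi.single s.1 1)) -
                c • (LinkGaussDiagram.unknots 1).leeMonomial 0 (e s) ∈
              LinearMap.range ((LinkGaussDiagram.unknots 1).khovanovD ℚ 0 1 (0 - 1) 0)) ∧
      (∃ Ψ : ((LinkGaussDiagram.unknots 1).degStates 0 → ℚ) →ₗ[ℚ]
          (P.diagram.degStates 0 → ℚ),
        (∀ w ∈ (LinkGaussDiagram.unknots 1).leeCycles, Ψ w ∈ P.diagram.leeCycles) ∧
        (∀ x, LinkGaussDiagram.qMin x ≤ GaussDiagram.qMin (Ψ x)) ∧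
        ∃ e : (LinkGaussDiagram.unknots 1).EnhancedState →
            {s : P.diagram.degStates 0 // ∀ i, ¬ P.diagram.Free s.1.label i},
          Injective e ∧ ∀ S, ∃ c : ℚ, c ≠ 0 ∧
            Ψ ((LinkGaussDiagram.unknots 1).leeMonomial 0 S) -
                c • (P.diagram.leeCoord 0).symm (Pi.single (e S).1 1) ∈
              LinearMap.range (P.diagram.khovanovD ℚ 0 1 (0 - 1) 0))) :
    eq_zero_of_isSmoothlySlice := by
  refine eq_zero_of_isSmoothlySlice_of_canonical fun {K} P hs ↦ ?_
  obtain ⟨⟨F, hFA, hFq, e, he, htrack⟩, ⟨Ψ, hΨB, hΨq, e', he', htrack'⟩⟩ := h P hs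
  exact ⟨LinkGaussDiagram.exists_canonical_of_unknotOne F hFA hFq e he htrack,
    LinkGaussDiagram.exists_canonical_of_unknotOne_symm Ψ hΨB hΨq e' he' htrack'⟩

end Literature.Topology.FourManifolds
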